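import Literature.Computability.Complexity.CodeFPModArith
import Literature.Computability.Complexity.TableauCSP
import HarnessLib

/-!
# Evaluating the arithmetized tableau with residues: addresses and constraint values of `tableauCSP`

Literature / complexity toolkit, machine-layer brick of the probabilistically checkable proofs for
exponential-time computations (Babai–Fortnow–Lund 1991 / Babai–Fortnow–Levin–Szegedy 1991; the
algebra is `AlgebraicPCP.lean`, the arithmetized Cook–Levin tableau `TableauCSP.tableauCSP M L P T x`
is `TableauCSP.lean`). Both the VERIFIER (its final check evaluates
`∑_φ λ^φ P_φ(r, corrected reads)`, `AlgebraicPCP.finalVal`, and its query map needs the read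
addresses `readAddr (addr_φ j) r`) and the honest PROVER (its sumcheck messages are sums of the
summand `Φ = (∑_φ λ^φ P_φ(z, Ŷ ∘ addr_φ(z))) · ∏ₜ EQ_H(zₜ, ρₜ)`, `AlgebraicPCP.Φ`) must EVALUATE the
constraint families of the tableau CSP at points `z ∈ 𝔽_pᴷ` that are NOT digit vectors, in time
polynomial in the parameters. This file gives that evaluation as arithmetic on RESIDUES (natural
numbers with the modulus `p` carried as data, the convention of `CodeFPModArith.lean`), mirroring the
recursive structure of the digit polynomials of `DigitPolynomials.lean` and the templates of
`TableauCSP.lean`, and proves that it computes the field quantities: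

* one digit: `eqCN`, `ltDN`, `eqVN`, `succDN` (the values of `[X = e]`, `[X < c]`, `[X = X']`,
  `[X' = X + 1]` at arbitrary residues; `cast_eqCN`, …, `cast_succDN`);
* digit vectors: `EQCN`, `LTCN` (by recursion on the digit list, constant `c` divided by `h` along),
  `EQVN`, `SUCCN` (on the zipped lists); `cast_EQCN`, `cast_LTCN`, `cast_EQVN`, `cast_SUCCN` — the
  residue value, cast to `ZMod p`, is `MvPolynomial.eval` of the digit polynomial at every point
  whose relevant coordinates are the given residues;
* the tableau: slots of an index given as the list of its `K` residues (`tD`, `t'D`, `cD`), the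
  guards `guardN` (tags `0 … 4`: trivial, start-row tail, step, interior window, cell), the clause
  value `clauseN`, the value `famValN` of a described family and the seeded sum
  **`psiN p … seed z yss fds = ∑ᵢ seedⁱ · guardᵢ(z) · clauseᵢ(yssᵢ)`**; read DESCRIPTORS (row source:
  constant / `t` / `t'`; column source: constant / window column `c`; value code) with their
  addresses `addrN` (the `m` residues of the tableau point read), and the descriptor list
  **`descs M L n P T x`** written in parallel with `xFams ++ nFams`;
* **bridges**: `forall₂_fams_descs` — family by family, in list order, the arity is the number of
  described reads, every read address `readAddr (addr j) z` is the cast of `addrN`, and the value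
  `Family.value φ z y` is the cast of `famValN` on the residues of `y` —, whence
  **`cast_psiN`**: `(psiN … : ZMod p) = ∑_φ seed^φ · (C.fam φ).value z (y φ)` for the CSP
  `C = tableauCSP M L P T x`, and `readAddr_eq_addrN`.

The polynomial running time of these maps in the typed algebra `CodeFP` is the sequel
(`TableauCSPEvalFP.lean`); here only the semantics and its correctness. No machine, no named fact.

## References

* L. Babai, L. Fortnow, C. Lund, *Non-deterministic exponential time has two-prover interactive
  protocols*, Comput. Complexity 1 (1991), §4 (arithmetization: the verifier evaluates the
  arithmetized clauses itself) [BabaiFortnowLund1991].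
* L. Babai, L. Fortnow, L. Levin, M. Szegedy, *Checking computations in polylogarithmic time*,
  STOC 1991, §4–§5 [BFLS1991].
* S. Arora, B. Barak, *Computational Complexity: A Modern Approach*, CUP 2009, §8.6, §11.5.2
  [AroraBarakCC2009].
-/

noncomputable section

open Finset

namespace Literature.Computability.Complexity

namespace TabEval

open ModArith DigitPoly AlgebraicPCP TableauCSP Turing Tableau

/-! ### One digit -/

section Sem

variable (p h : ℕ)

/-- Value of `[X = e]` at the residue `a`: the Lagrange basis value `L_e(a)` on `{0,…,h-1}`
(zero for `e ≥ h`). [cite: BFLS1991, §4] -/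
def eqCN (e a : ℕ) : ℕ := if e < h then lagrM p h e a else 0

/-- Value of `[X < c] = ∑_{e < min c h} [X = e]`. [folklore] -/
def ltDN (c a : ℕ) : ℕ := sumM p ((List.range (min c h)).map fun e => eqCN p h e a)

/-- Value of `[X = X'] = ∑_{e < h} [X = e][X' = e]`. [cite: BFLS1991, §4] -/
def eqVN (a b : ℕ) : ℕ := sumM p ((List.range h).map fun e => mulM p (eqCN p h e a) (eqCN p h e b))

/-- Value of `[X' = X + 1]` (no carry) `= ∑_{e < h-1} [X = e][X' = e+1]`. [folklore] -/
def succDN (a b : ℕ) : ℕ := sumM p ((List.range (h - 1)).map fun e => mulM p (eqCN p h e a) (eqCN p h (e + 1) b))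

/-! ### Digit vectors (least significant digit first) -/

/-- Value of `[val u = c]`, by recursion on the digit list (constant divided by `h` along).
[cite: BFLS1991, §4] -/
def EQCN : ℕ → List ℕ → ℕ
  | c, [] => if c = 0 then 1 % p else 0
  | c, u :: us => mulM p (eqCN p h (c % h) u) (EQCN (c / h) us)

/-- Value of `[val u < c]`, by recursion on the digit list. [folklore] -/
def LTCN : ℕ → List ℕ → ℕ
  | c, [] => if 0 < c then 1 % p else 0
  | c, u :: us => addM p (LTCN (c / h) us) (mulM p (EQCN p h (c / h) us) (ltDN p h (c % h) u))

/-- Value of `[u = u']` on the zipped digit lists. [folklore] -/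
def EQVN : List (ℕ × ℕ) → ℕ
  | [] => 1 % p
  | uv :: l => mulM p (eqVN p h uv.1 uv.2) (EQVN l)

/-- Value of `[val u' = val u + 1]` on the zipped digit lists. [cite: BabaiFortnowLund1991, §4] -/
def SUCCN : List (ℕ × ℕ) → ℕ
  | [] => 0
  | uv :: l => addM p (mulM p (succDN p h uv.1 uv.2) (EQVN p h l))
      (mulM p (mulM p (eqCN p h (h - 1) uv.1) (eqCN p h 0 uv.2)) (SUCCN l))

/-! ### The tableau: slots, guards, clause values, described families -/

variable (kt kJ : ℕ)

/-- The row digits `t` of an index given by its residues. [folklore] -/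
def tD (zl : List ℕ) : List ℕ := zl.take kt

/-- The row digits `t'`. [folklore] -/
def t'D (zl : List ℕ) : List ℕ := (zl.drop kt).take kt

/-- The digits of window column `c`. [folklore] -/
def cD (zl : List ℕ) (c : ℕ) : List ℕ := (zl.drop (kt + kt + kJ * c)).take kJ

variable (dd n P T : ℕ)

/-- `N = 2n + 2 + P` (input length of the tableau). [folklore] -/
def NNn : ℕ := 2 * n + 2 + P

/-- `S₁ = N + d T + 3 d` (last block of a row). [folklore] -/
def S1n : ℕ := NNn n P + dd * T + 3 * dd

/-- The step guard `[t < T][t' = t+1]`. [folklore] -/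
def stepGN (zl : List ℕ) : ℕ :=
  mulM p (LTCN p h T (tD kt zl)) (SUCCN p h ((tD kt zl).zip (t'D kt zl)))

/-- The cell guard `[t ≤ T][c₀ ≤ S₁]`. [folklore] -/
def cellGN (zl : List ℕ) : ℕ :=
  mulM p (LTCN p h (T + 1) (tD kt zl)) (LTCN p h (S1n dd n P T + 1) (cD kt kJ zl 0))

/-- The start-row tail guard `(1 - [c₀ < N+1]) [c₀ < S₁+1]`. [folklore] -/
def tailGN (zl : List ℕ) : ℕ :=
  mulM p (subM p 1 (LTCN p h (NNn n P + 1) (cD kt kJ zl 0))) (LTCN p h (S1n dd n P T + 1) (cD kt kJ zl 0))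

/-- The interior-window guard: step guard, consecutive columns, `d+1 ≤ c₀ < d+1+N+dT`. [folklore] -/
def intGN (zl : List ℕ) : ℕ :=
  mulM p (mulM p (mulM p (stepGN p h kt T zl)
    (prodM p ((List.range (2 * dd)).map fun i => SUCCN p h ((cD kt kJ zl i).zip (cD kt kJ zl (i + 1))))))
    (subM p 1 (LTCN p h (dd + 1) (cD kt kJ zl 0))))
    (LTCN p h (dd + 1 + NNn n P + dd * T) (cD kt kJ zl 0))

/-- **The guard of tag `g`**: `0` trivial, `1` tail, `2` step, `3` interior, `4` cell. [folklore] -/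
def guardN (zl : List ℕ) (g : ℕ) : ℕ :=
  if g = 0 then 1 % p
  else if g = 1 then tailGN p h kt kJ dd n P T zl
  else if g = 2 then stepGN p h kt T zl
  else if g = 3 then intGN p h kt kJ dd n P T zl
  else cellGN p h kt kJ dd n P T zl

/-- **The clause value** `∏_{premises} y · ∏_{conclusions} (1 - y)` on read residues. [cite: BabaiFortnowLund1991, §4] -/
def clauseN (prem concl : List ℕ) (ys : List ℕ) : ℕ :=
  mulM p (prodM p (prem.map fun j => ys.getD j 0)) (prodM p (concl.map fun j => subM p 1 (ys.getD j 0)))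

/-- A read descriptor: `((row tag, row constant), (column tag, column constant / window column),
value code)`; row tag `0` constant, `1` the index row `t`, `2` the row `t'`; column tag `0`
constant, `1` window column. [folklore] -/
abbrev RdDesc : Type := (ℕ × ℕ) × (ℕ × ℕ) × ℕ

/-- A family descriptor: `(guard tag, reads, premise indices, conclusion indices)`. [folklore] -/
abbrev FamDesc : Type := ℕ × List RdDesc × List ℕ × List ℕ

/-- **The value of a described family** on an index and read residues. [cite: BabaiFortnowLund1991, §4] -/
def famValN (zl ys : List ℕ) (fd : FamDesc) : ℕ :=
  mulM p (guardN p h kt kJ dd n P T zl fd.1) (clauseN p fd.2.2.1 fd.2.2.2 ys)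

/-- **The seeded sum of the family values** `∑ᵢ seedⁱ · valueᵢ` (the random combination `Ψ_λ` of
`AlgebraicPCP` with `λ_φ = seed^φ`), over the list of descriptors paired with their read residues.
[cite: AroraBarakCC2009, §11.5.2] -/
def psiN (seed : ℕ) (zl : List ℕ) (yss : List (List ℕ)) (fds : List FamDesc) : ℕ :=
  sumM p (((List.range (fds.zip yss).length).zip (fds.zip yss)).map fun t =>
    mulM p (powM p seed t.1) (famValN p h kt kJ dd n P T zl t.2.2 t.2.1))

/-- The base-`h` digits of a constant, `k` of them. [folklore] -/
def constDigits (k N : ℕ) : List ℕ := (List.range k).map fun i => N / h ^ i % h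

/-- The row digits of a read: constant digits, or the slot `t`, or the slot `t'`. [folklore] -/
def rowDigs (zl : List ℕ) (rs : ℕ × ℕ) : List ℕ :=
  if rs.1 = 0 then constDigits h kt rs.2 else if rs.1 = 1 then tD kt zl else t'D kt zl

/-- The column digits of a read: constant digits or a window column of the index. [folklore] -/
def colDigs (zl : List ℕ) (cs : ℕ × ℕ) : List ℕ :=
  if cs.1 = 0 then constDigits h kJ cs.2 else cD kt kJ zl cs.2

/-- **The address of a described read**: the `m = kt + kJ + 1` residues of the tableau point
(row digits, column digits, value code). [cite: BabaiFortnowLund1991, §4] -/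
def addrN (zl : List ℕ) (rd : RdDesc) : List ℕ :=
  rowDigs h kt zl rd.1 ++ (colDigs h kt kJ zl rd.2.1 ++ [rd.2.2])

end Sem

/-! ### Bridges, one digit -/

section Bridge

variable {p : ℕ} [hp : Fact p.Prime] {h : ℕ} (hh : h ≤ p) {σ : Type*}

/-- The node sets of `CodeFPModArith` and `DigitPolynomials` agree. [folklore] -/
theorem nodes_eq : ModArith.nodes p h = DigitPoly.nodes (F := ZMod p) h := rfl

include hh

/-- `eqCN` is the value of `[X_v = e]`. [cite: BFLS1991, §4] -/
theorem cast_eqCN (e a : ℕ) {pt : σ → ZMod p} {v : σ} (hv : pt v = (a : ZMod p)) :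
    ((eqCN p h e a : ℕ) : ZMod p) = MvPolynomial.eval pt (eqC (F := ZMod p) h e v) := by
  unfold eqCN eqC
  by_cases he : e < h
  · rw [if_pos he, if_pos he, MvPolynomial.eval_toMvPolynomial, hv, natCast_lagrM hh he a, nodes_eq]
  · rw [if_neg he, if_neg he, map_zero, Nat.cast_zero]

/-- `ltDN` is the value of `[X_v < c]`. [folklore] -/
theorem cast_ltDN (c a : ℕ) {pt : σ → ZMod p} {v : σ} (hv : pt v = (a : ZMod p)) :
    ((ltDN p h c a : ℕ) : ZMod p) = MvPolynomial.eval pt (ltD (F := ZMod p) h c v) := by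
  unfold ltDN ltD
  rw [natCast_sumM, List.map_map, sum_map_range, map_sum]
  exact sum_congr rfl fun e _ => cast_eqCN hh e a hv

/-- `eqVN` is the value of `[X_v = X_{v'}]`. [cite: BFLS1991, §4] -/
theorem cast_eqVN (a b : ℕ) {pt : σ → ZMod p} {v v' : σ} (hv : pt v = (a : ZMod p)) (hv' : pt v' = (b : ZMod p)) :
    ((eqVN p h a b : ℕ) : ZMod p) = MvPolynomial.eval pt (eqV (F := ZMod p) h v v') := by
  unfold eqVN eqV
  rw [natCast_sumM, List.map_map, sum_map_range, map_sum]
  refine sum_congr rfl fun e _ => ?_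
  rw [Function.comp_apply, natCast_mulM, map_mul, cast_eqCN hh e a hv, cast_eqCN hh e b hv']

/-- `succDN` is the value of `[X_{v'} = X_v + 1]`. [folklore] -/
theorem cast_succDN (a b : ℕ) {pt : σ → ZMod p} {v v' : σ} (hv : pt v = (a : ZMod p)) (hv' : pt v' = (b : ZMod p)) :
    ((succDN p h a b : ℕ) : ZMod p) = MvPolynomial.eval pt (succD (F := ZMod p) h v v') := by
  unfold succDN succD
  rw [natCast_sumM, List.map_map, sum_map_range, map_sum]
  refine sum_congr rfl fun e _ => ?_
  rw [Function.comp_apply, natCast_mulM, map_mul, cast_eqCN hh e a hv, cast_eqCN hh (e + 1) b hv']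

/-! ### Bridges, digit vectors -/

/-- `EQCN` is the value of `[val u = c]`. [cite: BFLS1991, §4] -/
theorem cast_EQCN {pt : σ → ZMod p} : ∀ (k c : ℕ) (U : Fin k → σ) (us : List ℕ), us.length = k →
    (∀ i : Fin k, pt (U i) = ((us.getD i 0 : ℕ) : ZMod p)) →
    ((EQCN p h c us : ℕ) : ZMod p) = MvPolynomial.eval pt (EQC (F := ZMod p) h k c U)
  | 0, c, U, us, hlen, _ => by
    rw [List.length_eq_zero_iff.1 hlen]
    unfold EQCN EQC
    split_ifs <;> simp
  | k + 1, c, U, us, hlen, hpt => by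
    obtain ⟨u, us', rfl⟩ : ∃ u us', us = u :: us' := by
      cases us with
      | nil => simp at hlen
      | cons u us' => exact ⟨u, us', rfl⟩
    rw [List.length_cons, Nat.add_right_cancel_iff] at hlen
    rw [EQCN, EQC, natCast_mulM, map_mul, cast_eqCN hh (c % h) u (hpt 0),
      cast_EQCN k (c / h) (fun i => U i.succ) us' hlen fun i => by simpa using hpt i.succ]

/-- `LTCN` is the value of `[val u < c]`. [folklore] -/
theorem cast_LTCN {pt : σ → ZMod p} : ∀ (k c : ℕ) (U : Fin k → σ) (us : List ℕ), us.length = k →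
    (∀ i : Fin k, pt (U i) = ((us.getD i 0 : ℕ) : ZMod p)) →
    ((LTCN p h c us : ℕ) : ZMod p) = MvPolynomial.eval pt (LTC (F := ZMod p) h k c U)
  | 0, c, U, us, hlen, _ => by
    rw [List.length_eq_zero_iff.1 hlen]
    unfold LTCN LTC
    split_ifs <;> simp
  | k + 1, c, U, us, hlen, hpt => by
    obtain ⟨u, us', rfl⟩ : ∃ u us', us = u :: us' := by
      cases us with
      | nil => simp at hlen
      | cons u us' => exact ⟨u, us', rfl⟩
    rw [List.length_cons, Nat.add_right_cancel_iff] at hlen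
    have hpt' : ∀ i : Fin k, pt (U i.succ) = ((us'.getD i 0 : ℕ) : ZMod p) := fun i => by simpa using hpt i.succ
    rw [LTCN, LTC, natCast_addM, natCast_mulM, map_add, map_mul, cast_LTCN k (c / h) (fun i => U i.succ) us' hlen hpt',
      cast_EQCN hh k (c / h) (fun i => U i.succ) us' hlen hpt', cast_ltDN hh (c % h) u (hpt 0)]

/-- `EQVN` is the value of `[u = u']`. [folklore] -/
theorem cast_EQVN {pt : σ → ZMod p} : ∀ (k : ℕ) (U U' : Fin k → σ) (l : List (ℕ × ℕ)), l.length = k →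
    (∀ i : Fin k, pt (U i) = (((l.getD i (0, 0)).1 : ℕ) : ZMod p)) →
    (∀ i : Fin k, pt (U' i) = (((l.getD i (0, 0)).2 : ℕ) : ZMod p)) →
    ((EQVN p h l : ℕ) : ZMod p) = MvPolynomial.eval pt (EQV (F := ZMod p) h k U U')
  | 0, U, U', l, hlen, _, _ => by
    rw [List.length_eq_zero_iff.1 hlen]
    unfold EQVN EQV
    simp
  | k + 1, U, U', l, hlen, hpt, hpt' => by
    obtain ⟨uv, l', rfl⟩ : ∃ uv l', l = uv :: l' := by
      cases l with
      | nil => simp at hlen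
      | cons uv l' => exact ⟨uv, l', rfl⟩
    rw [List.length_cons, Nat.add_right_cancel_iff] at hlen
    rw [EQVN, EQV, natCast_mulM, map_mul, cast_eqVN hh uv.1 uv.2 (hpt 0) (hpt' 0),
      cast_EQVN k (fun i => U i.succ) (fun i => U' i.succ) l' hlen (fun i => by simpa using hpt i.succ)
        fun i => by simpa using hpt' i.succ]

/-- `SUCCN` is the value of `[val u' = val u + 1]`. [cite: BabaiFortnowLund1991, §4] -/
theorem cast_SUCCN {pt : σ → ZMod p} : ∀ (k : ℕ) (U U' : Fin k → σ) (l : List (ℕ × ℕ)), l.length = k →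
    (∀ i : Fin k, pt (U i) = (((l.getD i (0, 0)).1 : ℕ) : ZMod p)) →
    (∀ i : Fin k, pt (U' i) = (((l.getD i (0, 0)).2 : ℕ) : ZMod p)) →
    ((SUCCN p h l : ℕ) : ZMod p) = MvPolynomial.eval pt (SUCC (F := ZMod p) h k U U')
  | 0, U, U', l, hlen, _, _ => by
    rw [List.length_eq_zero_iff.1 hlen]
    unfold SUCCN SUCC
    simp
  | k + 1, U, U', l, hlen, hpt, hpt' => by
    obtain ⟨uv, l', rfl⟩ : ∃ uv l', l = uv :: l' := by
      cases l with
      | nil => simp at hlen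
      | cons uv l' => exact ⟨uv, l', rfl⟩
    rw [List.length_cons, Nat.add_right_cancel_iff] at hlen
    have h1 : ∀ i : Fin k, pt (U i.succ) = (((l'.getD i (0, 0)).1 : ℕ) : ZMod p) := fun i => by simpa using hpt i.succ
    have h2 : ∀ i : Fin k, pt (U' i.succ) = (((l'.getD i (0, 0)).2 : ℕ) : ZMod p) := fun i => by simpa using hpt' i.succ
    rw [SUCCN, SUCC, natCast_addM, natCast_mulM, natCast_mulM, natCast_mulM, map_add, map_mul, map_mul, map_mul,
      cast_succDN hh uv.1 uv.2 (hpt 0) (hpt' 0), cast_EQVN hh k _ _ l' hlen h1 h2,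
      cast_eqCN hh (h - 1) uv.1 (hpt 0), cast_eqCN hh 0 uv.2 (hpt' 0), cast_SUCCN k _ _ l' hlen h1 h2]

end Bridge

/-! ### List plumbing -/

section Lists

/-- `getD` of `List.ofFn`. [folklore] -/
theorem getD_ofFn {α : Type*} {k : ℕ} (f : Fin k → α) (i : Fin k) (d : α) : (List.ofFn f).getD i d = f i := by
  rw [List.getD_eq_getElem?_getD, List.getElem?_ofFn]
  simp

/-- `getD` of a `take` below the cut. [folklore] -/
theorem getD_take_of_lt {α : Type*} (l : List α) {k i : ℕ} (hi : i < k) (d : α) : (l.take k).getD i d = l.getD i d := by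
  rw [List.getD_eq_getElem?_getD, List.getElem?_take_of_lt hi, ← List.getD_eq_getElem?_getD]

/-- `getD` of a `drop`. [folklore] -/
theorem getD_drop {α : Type*} (l : List α) (a i : ℕ) (d : α) : (l.drop a).getD i d = l.getD (a + i) d := by
  rw [List.getD_eq_getElem?_getD, List.getElem?_drop, ← List.getD_eq_getElem?_getD]

/-- `getD` of a `zip` of two lists at an index inside both. [folklore] -/
theorem getD_zip {α β : Type*} (l : List α) (l' : List β) {i : ℕ} (hi : i < l.length) (hi' : i < l'.length) (a : α) (b : β) :
    (l.zip l').getD i (a, b) = (l.getD i a, l'.getD i b) := by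
  rw [List.getD_eq_getElem _ _ (by rw [List.length_zip]; exact lt_min hi hi'), List.getElem_zip,
    List.getD_eq_getElem _ _ hi, List.getD_eq_getElem _ _ hi']

/-- `Forall₂` along two maps of one list. [folklore] -/
theorem forall₂_map_map {α β γ : Type*} {R : β → γ → Prop} {f : α → β} {g : α → γ} :
    ∀ (l : List α), (∀ a ∈ l, R (f a) (g a)) → List.Forall₂ R (l.map f) (l.map g)
  | [], _ => List.Forall₂.nil
  | a :: l, hl => List.Forall₂.cons (hl a (by simp)) (forall₂_map_map l fun b hb => hl b (by simp [hb]))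

/-- `Forall₂` along two `flatMap`s of one list. [folklore] -/
theorem forall₂_flatMap_flatMap {α β γ : Type*} {R : β → γ → Prop} {f : α → List β} {g : α → List γ} :
    ∀ (l : List α), (∀ a ∈ l, List.Forall₂ R (f a) (g a)) → List.Forall₂ R (l.flatMap f) (l.flatMap g)
  | [], _ => by simp
  | a :: l, hl => by
    rw [List.flatMap_cons, List.flatMap_cons]
    exact List.rel_append (hl a (by simp)) (forall₂_flatMap_flatMap l fun b hb => hl b (by simp [hb]))

end Lists

/-! ### Bridges for the tableau: slots -/

section Tab

variable {p : ℕ} [hp : Fact p.Prime]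
variable (M : TM2ComputableAux Bool Bool) (L : Layout)

attribute [local instance] Turing.FinTM2.kFin Turing.FinTM2.ΛFin Turing.FinTM2.σFin
  Turing.FinTM2.Γk₀Fin

local notation "d" => dM M
local notation "K" => KIdx L (dM M)
local notation "m" => mPt L

/-- The residues of an index. [folklore] -/
def zlOf (z : Fin K → ZMod p) : List ℕ := List.ofFn fun q => (z q).val

omit hp in
/-- Length of the residue list. [folklore] -/
@[simp] theorem length_zlOf (z : Fin K → ZMod p) : (zlOf M L z).length = K := by simp [zlOf]

omit hp in
/-- The residue list at a coordinate. [folklore] -/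
theorem getD_zlOf (z : Fin K → ZMod p) (q : Fin K) : (zlOf M L z).getD q 0 = (z q).val := getD_ofFn _ q 0

omit hp in
/-- Coordinate value of `tSlot i`. [folklore] -/
theorem val_tSlot (i : Fin L.kt) : ((@tSlot L (dM M) i : Fin K) : ℕ) = i := rfl

omit hp in
/-- Coordinate value of `t'Slot i`. [folklore] -/
theorem val_t'Slot (i : Fin L.kt) : ((@t'Slot L (dM M) i : Fin K) : ℕ) = L.kt + i := rfl

omit hp in
/-- Coordinate value of `cSlot c i`. [folklore] -/
theorem val_cSlot (c : Fin (2 * d + 1)) (i : Fin L.kJ) : ((cSlot c i : Fin K) : ℕ) = L.kt + L.kt + (i + L.kJ * c) := rfl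

omit hp in
/-- The residue of the index at the slot `tSlot i` is digit `i` of `tD`. [folklore] -/
theorem getD_tD (z : Fin K → ZMod p) (i : Fin L.kt) : (tD L.kt (zlOf M L z)).getD i 0 = (z (tSlot i)).val := by
  rw [tD, getD_take_of_lt _ i.2, ← getD_zlOf M L z (tSlot i), val_tSlot]

omit hp in
/-- The residue at `t'Slot i` is digit `i` of `t'D`. [folklore] -/
theorem getD_t'D (z : Fin K → ZMod p) (i : Fin L.kt) : (t'D L.kt (zlOf M L z)).getD i 0 = (z (t'Slot i)).val := by
  rw [t'D, getD_take_of_lt _ i.2, getD_drop, ← getD_zlOf M L z (t'Slot i), val_t'Slot]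

omit hp in
/-- The residue at `cSlot c i` is digit `i` of `cD c`. [folklore] -/
theorem getD_cD (z : Fin K → ZMod p) (c : Fin (2 * d + 1)) (i : Fin L.kJ) :
    (cD L.kt L.kJ (zlOf M L z) c).getD i 0 = (z (cSlot c i)).val := by
  rw [cD, getD_take_of_lt _ i.2, getD_drop, ← getD_zlOf M L z (cSlot c i), val_cSlot]
  congr 1
  ring

omit hp in
/-- Length of `tD`. [folklore] -/
@[simp] theorem length_tD (z : Fin K → ZMod p) : (tD L.kt (zlOf M L z)).length = L.kt := by
  simp only [tD, List.length_take, length_zlOf, KIdx]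
  generalize (2 * d + 1) * L.kJ = X
  omega

omit hp in
/-- Length of `t'D`. [folklore] -/
@[simp] theorem length_t'D (z : Fin K → ZMod p) : (t'D L.kt (zlOf M L z)).length = L.kt := by
  simp only [t'D, List.length_take, List.length_drop, length_zlOf, KIdx]
  generalize (2 * d + 1) * L.kJ = X
  omega

omit hp in
/-- Length of `cD c` for a window column. [folklore] -/
theorem length_cD (z : Fin K → ZMod p) {c : ℕ} (hc : c < 2 * d + 1) : (cD L.kt L.kJ (zlOf M L z) c).length = L.kJ := by
  simp only [cD, List.length_take, List.length_drop, length_zlOf, KIdx]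
  have : L.kJ * c + L.kJ ≤ (2 * d + 1) * L.kJ := by nlinarith
  generalize (2 * d + 1) * L.kJ = X at this
  generalize L.kJ * c = Y at this
  omega

variable {M L}

/-- `LTC` on the row `t`. [folklore] -/
theorem cast_LTCN_t (hh : L.h ≤ p) {r : ℕ} (z : Fin K → ZMod p) (y : Fin r → ZMod p) (c : ℕ) :
    ((LTCN p L.h c (tD L.kt (zlOf M L z)) : ℕ) : ZMod p) = MvPolynomial.eval (Sum.elim z y) (LTC L.h L.kt c (Ut M L)) :=
  cast_LTCN hh _ _ _ _ (length_tD M L z) fun i => by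
    rw [getD_tD, ZMod.natCast_zmod_val]; rfl

/-- `LTC` on a window column. [folklore] -/
theorem cast_LTCN_c (hh : L.h ≤ p) {r : ℕ} (z : Fin K → ZMod p) (y : Fin r → ZMod p) (c : ℕ) (cc : Fin (2 * d + 1)) :
    ((LTCN p L.h c (cD L.kt L.kJ (zlOf M L z) cc) : ℕ) : ZMod p) =
      MvPolynomial.eval (Sum.elim z y) (LTC L.h L.kJ c (Uc M L cc)) :=
  cast_LTCN hh _ _ _ _ (length_cD M L z cc.2) fun i => by
    rw [getD_cD, ZMod.natCast_zmod_val]; rfl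

/-- `SUCC` on the rows `t, t'`. [folklore] -/
theorem cast_SUCCN_t (hh : L.h ≤ p) {r : ℕ} (z : Fin K → ZMod p) (y : Fin r → ZMod p) :
    ((SUCCN p L.h ((tD L.kt (zlOf M L z)).zip (t'D L.kt (zlOf M L z))) : ℕ) : ZMod p) =
      MvPolynomial.eval (Sum.elim z y) (SUCC L.h L.kt (Ut M L) (Ut' M L)) := by
  refine cast_SUCCN hh _ _ _ _ (by simp) (fun i => ?_) fun i => ?_
  · rw [getD_zip _ _ (by simp) (by simp)]; dsimp only; rw [getD_tD, ZMod.natCast_zmod_val]; rfl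
  · rw [getD_zip _ _ (by simp) (by simp)]; dsimp only; rw [getD_t'D, ZMod.natCast_zmod_val]; rfl

/-- `SUCC` on two window columns. [folklore] -/
theorem cast_SUCCN_c (hh : L.h ≤ p) {r : ℕ} (z : Fin K → ZMod p) (y : Fin r → ZMod p) (a b : Fin (2 * d + 1)) :
    ((SUCCN p L.h ((cD L.kt L.kJ (zlOf M L z) a).zip (cD L.kt L.kJ (zlOf M L z) b)) : ℕ) : ZMod p) =
      MvPolynomial.eval (Sum.elim z y) (SUCC L.h L.kJ (Uc M L a) (Uc M L b)) := by
  have ha := length_cD M L z a.2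
  have hb := length_cD M L z b.2
  refine cast_SUCCN hh _ _ _ _ (by simp [ha, hb]) (fun i => ?_) fun i => ?_
  · rw [getD_zip _ _ (by omega) (by omega)]; dsimp only; rw [getD_cD, ZMod.natCast_zmod_val]; rfl
  · rw [getD_zip _ _ (by omega) (by omega)]; dsimp only; rw [getD_cD, ZMod.natCast_zmod_val]; rfl

/-! ### Bridges for the tableau: guards and clauses -/

variable {n P T : ℕ}

/-- `1 - x` as residues. [folklore] -/
theorem cast_subM_one (x : ℕ) : ((subM p 1 x : ℕ) : ZMod p) = 1 - (x : ZMod p) := by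
  rw [natCast_subM, Nat.cast_one]

/-- The step guard. [folklore] -/
theorem cast_stepGN (hh : L.h ≤ p) {r : ℕ} (z : Fin K → ZMod p) (y : Fin r → ZMod p) :
    ((stepGN p L.h L.kt T (zlOf M L z) : ℕ) : ZMod p) = MvPolynomial.eval (Sum.elim z y) (stepGuard M L T) := by
  rw [stepGN, stepGuard, natCast_mulM, map_mul, cast_LTCN_t hh, cast_SUCCN_t hh]

/-- The cell guard. [folklore] -/
theorem cast_cellGN (hh : L.h ≤ p) {r : ℕ} (z : Fin K → ZMod p) (y : Fin r → ZMod p) :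
    ((cellGN p L.h L.kt L.kJ d n P T (zlOf M L z) : ℕ) : ZMod p) = MvPolynomial.eval (Sum.elim z y) (cellGuard M L n P T) := by
  rw [cellGN, cellGuard, natCast_mulM, map_mul, cast_LTCN_t hh, cast_LTCN_c hh z y _ ⟨0, by omega⟩]
  rfl

/-- The tail guard. [folklore] -/
theorem cast_tailGN (hh : L.h ≤ p) {r : ℕ} (z : Fin K → ZMod p) (y : Fin r → ZMod p) (hd0 : 0 < 2 * d + 1) :
    ((tailGN p L.h L.kt L.kJ d n P T (zlOf M L z) : ℕ) : ZMod p) =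
      MvPolynomial.eval (Sum.elim z y) ((1 - LTC L.h L.kJ (NN n P + 1) (Uc M L ⟨0, hd0⟩)) *
        LTC L.h L.kJ (S1 M n P T + 1) (Uc M L ⟨0, hd0⟩)) := by
  rw [tailGN, natCast_mulM, map_mul, map_sub, map_one, cast_subM_one, cast_LTCN_c hh z y _ ⟨0, hd0⟩,
    cast_LTCN_c hh z y _ ⟨0, hd0⟩]
  rfl

/-- The interior guard. [folklore] -/
theorem cast_intGN (hh : L.h ≤ p) {r : ℕ} (z : Fin K → ZMod p) (y : Fin r → ZMod p) :
    ((intGN p L.h L.kt L.kJ d n P T (zlOf M L z) : ℕ) : ZMod p) = MvPolynomial.eval (Sum.elim z y) (intGuard M L n P T) := by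
  rw [intGN, intGuard, natCast_mulM, natCast_mulM, natCast_mulM, map_mul, map_mul, map_mul, cast_stepGN hh,
    natCast_prodM, List.map_map, map_list_prod, List.map_map, map_sub, map_one, cast_subM_one,
    cast_LTCN_c hh z y _ ⟨0, by omega⟩, cast_LTCN_c hh z y _ ⟨0, by omega⟩]
  have hprod : ((List.range (2 * d)).map ((Nat.cast : ℕ → ZMod p) ∘ fun i =>
      SUCCN p L.h ((cD L.kt L.kJ (zlOf M L z) i).zip (cD L.kt L.kJ (zlOf M L z) (i + 1))))).prod =
      ((List.finRange (2 * d)).map ((MvPolynomial.eval (Sum.elim z y)) ∘ fun i : Fin (2 * d) =>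
        SUCC L.h L.kJ (Uc M L (Fin.castSucc i)) (Uc M L i.succ))).prod := by
    rw [← List.map_coe_finRange_eq_range, List.map_map]
    congr 1
    refine List.map_congr_left fun i _ => ?_
    simp only [Function.comp_apply]
    exact cast_SUCCN_c hh z y (Fin.castSucc i) i.succ
  rw [hprod]
  rfl

/-- **The guard of each tag.** [folklore] -/
theorem cast_guardN_step (hh : L.h ≤ p) {r : ℕ} (z : Fin K → ZMod p) (y : Fin r → ZMod p) :
    ((guardN p L.h L.kt L.kJ d n P T (zlOf M L z) 2 : ℕ) : ZMod p) = MvPolynomial.eval (Sum.elim z y) (stepGuard M L T) := by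
  unfold guardN; simp only [show (2 : ℕ) ≠ 0 from by decide, show (2 : ℕ) ≠ 1 from by decide, if_false, if_true]
  exact cast_stepGN hh z y

/-- **The clause value.** [cite: BabaiFortnowLund1991, §4] -/
theorem cast_clauseN {Kk r : ℕ} (z : Fin Kk → ZMod p) (y : Fin r → ZMod p) (prem concl : List (Fin r)) :
    ((clauseN p (prem.map Fin.val) (concl.map Fin.val) (List.ofFn fun j => (y j).val) : ℕ) : ZMod p) =
      MvPolynomial.eval (Sum.elim z y) (clausePoly prem concl : MvPolynomial (Fin Kk ⊕ Fin r) (ZMod p)) := by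
  rw [clauseN, eval_clausePoly, natCast_mulM, natCast_prodM, natCast_prodM, List.map_map, List.map_map, List.map_map,
    List.map_map]
  congr 1
  · congr 1
    refine List.map_congr_left fun j _ => ?_
    simp only [Function.comp_apply, Sum.elim_inr]
    rw [getD_ofFn (fun j => (y j).val) j 0, ZMod.natCast_zmod_val]
  · congr 1
    refine List.map_congr_left fun j _ => ?_
    simp only [Function.comp_apply, Sum.elim_inr]
    rw [cast_subM_one, getD_ofFn (fun j => (y j).val) j 0, ZMod.natCast_zmod_val]

/-! ### Descriptors of the families -/

variable (M L) (n P T)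

/-- Value code of a block value. [folklore] -/
abbrev vc (v : Val M.tm) : ℕ := vcode M v

/-- Descriptor of a unit family. [folklore] -/
def unitD (t0 J0 : ℕ) (v : Val M.tm) : FamDesc := (0, [((0, t0), (0, J0), vc M v)], [], [0])

/-- Descriptor of the tail family. [folklore] -/
def tailD : FamDesc := (1, [((0, 0), (1, 0), vc M (noneVal M.tm))], [], [0])

/-- Descriptor of `certAnyFam j`. [folklore] -/
def certAnyD (j : ℕ) : FamDesc :=
  (0, (List.finRange 3).map fun k => ((0, 0), (0, 2 * n + 3 + j), vc M (certVal M k)), [], [0, 1, 2])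

/-- Descriptor of `certNextFam j`. [folklore] -/
def certNextD (j : ℕ) : FamDesc :=
  (0, (List.finRange 2).map fun k : Fin 2 => ((0, 0), (0, 2 * n + 3 + j + k), vc M (noneVal M.tm)), [0], [1])

/-- Descriptor of `topFam a r`. [folklore] -/
def topD (a : Fin (3 * d + 1) → Val M.tm) (r : Fin (2 * d + 1)) : FamDesc :=
  (2, ((List.finRange (3 * d + 1)).map fun s : Fin (3 * d + 1) => ((1, 0), (0, s.val), vc M (a s))) ++
      [((2, 0), (0, (r : ℕ)), vc M (topF d a r))],
    (List.finRange (3 * d + 1)).map Fin.val, [3 * d + 1])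

/-- Descriptor of `intFam hh nb`. [folklore] -/
def intD (hd' : Fin (d + 1) → Val M.tm) (nb : Fin (2 * d + 1) → Val M.tm) : FamDesc :=
  (3, ((List.finRange (d + 1)).map fun s : Fin (d + 1) => ((1, 0), (0, s.val), vc M (hd' s))) ++
      (((List.finRange (2 * d + 1)).map fun s : Fin (2 * d + 1) => ((1, 0), (1, s.val), vc M (nb s))) ++
      [((2, 0), (1, d), vc M (intF d hd' nb))]),
    (List.range ((d + 1) + (2 * d + 1))), [(d + 1) + (2 * d + 1)])

/-- Descriptor of `botFam r`. [folklore] -/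
def botD (r : ℕ) : FamDesc := (2, [((2, 0), (0, NN n P + d * T + 2 * d + 1 + r), vc M (noneVal M.tm))], [], [0])

/-- Descriptor of `cellAnyFam`. [folklore] -/
def cellAnyD : FamDesc :=
  (4, (List.range (Nat.card (Val M.tm))).map fun j => ((1, 0), (1, 0), j), [], List.range (Nat.card (Val M.tm)))

/-- Descriptor of `cellPairFam v v'`. [folklore] -/
def cellPairD (v v' : Val M.tm) : FamDesc := (4, [((1, 0), (1, 0), vc M v), ((1, 0), (1, 0), vc M v')], [0, 1], [])

open scoped Classical in
/-- **The descriptors of `nFams M L n P T`**, in the same order. [cite: BabaiFortnowLund1991, §4] -/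
def nDescs : List FamDesc :=
  [unitD M 0 0 (ctrlVal M), unitD M 0 (2 * n + 1) (symVal M false), unitD M 0 (2 * n + 2) (symVal M true),
    tailD M, unitD M T 1 (accVal M), cellAnyD M] ++
  ((List.range P).flatMap fun j => [certAnyD M n j, certNextD M n j]) ++
  ((allTuples M (3 * d + 1)).flatMap fun a => (List.finRange (2 * d + 1)).map fun r => topD M a r) ++
  ((allTuples M (d + 1)).flatMap fun hd' => (allTuples M (2 * d + 1)).map fun nb => intD M hd' nb) ++
  ((List.range d).map fun r => botD M n P T r) ++
  ((allVals M).flatMap fun v => (allVals M).flatMap fun v' => if v = v' then [] else [cellPairD M v v'])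

/-- **The descriptors of `xFams M L x`**, in the same order. [folklore] -/
def xDescs (x : List Bool) : List FamDesc :=
  x.zipIdx.flatMap fun q => [unitD M 0 (2 * q.2 + 1) (symVal M q.1), unitD M 0 (2 * q.2 + 2) (symVal M q.1)]

/-- **The descriptors of the tableau CSP** `tableauCSP M L P T x`. [cite: BabaiFortnowLund1991, §4] -/
def descs (x : List Bool) : List FamDesc := xDescs M x ++ nDescs M n P T

/-! ### The correspondence family ↔ descriptor -/

variable {M L n P T}

/-- **A family is described by a descriptor** (over the residues of indices): same number of
reads, the read addresses are the casts of `addrN`, and the value on every index and reads is the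
cast of `famValN`. [folklore] -/
def Described (φ : Family (ZMod p) K m) (fd : FamDesc) : Prop :=
  φ.arity = fd.2.1.length ∧
  (∀ (z : Fin K → ZMod p) (j : Fin φ.arity),
    readAddr (φ.addr j) z = fun u : Fin m => (((addrN L.h L.kt L.kJ (zlOf M L z) (fd.2.1.getD j ((0, 0), (0, 0), 0))).getD u 0 : ℕ) : ZMod p)) ∧
  (∀ (z : Fin K → ZMod p) (y : Fin φ.arity → ZMod p),
    φ.value z y = ((famValN p L.h L.kt L.kJ d n P T (zlOf M L z) (List.ofFn fun j => (y j).val) fd : ℕ) : ZMod p))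

/-! #### Addresses -/

omit hp in
/-- A coordinate with the value of a row digit position is that row digit. [folklore] -/
theorem mkPt_of_val_row {F : Type} (nt : Fin L.kt → F) (nJ : Fin L.kJ → F) (c : F) (u : Fin m) (i : Fin L.kt)
    (hu : (u : ℕ) = i) : mkPt nt nJ c u = nt i := by
  have : u = ptEquiv L (Sum.inl (Sum.inl i)) := Fin.ext (by rw [hu]; rfl)
  rw [this, mkPt_row]

omit hp in
/-- A coordinate with the value of a column digit position is that column digit. [folklore] -/
theorem mkPt_of_val_col {F : Type} (nt : Fin L.kt → F) (nJ : Fin L.kJ → F) (c : F) (u : Fin m) (i : Fin L.kJ)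
    (hu : (u : ℕ) = L.kt + i) : mkPt nt nJ c u = nJ i := by
  have : u = ptEquiv L (Sum.inl (Sum.inr i)) := Fin.ext (by rw [hu]; rfl)
  rw [this, mkPt_col]

omit hp in
/-- The last coordinate is the value. [folklore] -/
theorem mkPt_of_val_val {F : Type} (nt : Fin L.kt → F) (nJ : Fin L.kJ → F) (c : F) (u : Fin m)
    (hu : (u : ℕ) = L.kt + L.kJ) : mkPt nt nJ c u = c := by
  have : u = ptEquiv L (Sum.inr 0) := Fin.ext (by rw [hu]; rfl)
  rw [this, mkPt_val]

omit hp in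
/-- **A point as the list of its coordinates**: row digits, column digits, value. [folklore] -/
theorem ofFn_mkPt {F : Type} (nt : Fin L.kt → F) (nJ : Fin L.kJ → F) (c : F) :
    List.ofFn (mkPt nt nJ c) = List.ofFn nt ++ (List.ofFn nJ ++ [c]) := by
  change List.ofFn (n := (L.kt + L.kJ) + 1) (mkPt nt nJ c) = _
  rw [List.ofFn_add, List.ofFn_add, List.append_assoc]
  congr 1
  · exact List.ofFn_inj.2 (funext fun i => mkPt_of_val_row nt nJ c _ i rfl)
  · congr 1
    · exact List.ofFn_inj.2 (funext fun i => mkPt_of_val_col nt nJ c _ i rfl)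
    · rw [List.ofFn_succ, List.ofFn_zero]
      congr 1
      exact mkPt_of_val_val nt nJ c _ rfl

omit hp in
/-- A function on `Fin m` from its coordinate list. [folklore] -/
theorem eq_getD_of_ofFn_eq {α : Type*} {k : ℕ} {f : Fin k → α} {l : List α} (hl : List.ofFn f = l) (d0 : α) :
    f = fun u : Fin k => l.getD (u : ℕ) d0 := by
  funext u
  rw [← hl, getD_ofFn]

/-- Constant digits, read. [folklore] -/
theorem ofFn_constDig (z : Fin K → ZMod p) (k N : ℕ) :
    List.ofFn (fun i : Fin k => Sum.elim z id ((constDig L.h N : Fin k → Fin K ⊕ ZMod p) i)) =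
      (constDigits L.h k N).map (Nat.cast : ℕ → ZMod p) := by
  unfold constDig constDigits digitsOf
  rw [List.map_map, ← List.map_coe_finRange_eq_range, List.map_map, List.ofFn_eq_map]
  rfl

/-- The row `t`, read. [folklore] -/
theorem ofFn_varDig_t (z : Fin K → ZMod p) :
    List.ofFn (fun i : Fin L.kt => Sum.elim z id (varDig (F := ZMod p) (@tSlot L (dM M)) i)) =
      (tD L.kt (zlOf M L z)).map (Nat.cast : ℕ → ZMod p) := by
  apply List.ext_getElem
  · simp
  · intro i h1 h2
    rw [List.length_ofFn] at h1
    rw [List.getElem_ofFn, List.getElem_map]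
    have := getD_tD M L z ⟨i, h1⟩
    rw [List.getD_eq_getElem _ _ (by simpa using h2)] at this
    simp only [varDig, Sum.elim_inl]
    rw [this, ZMod.natCast_zmod_val]

/-- The row `t'`, read. [folklore] -/
theorem ofFn_varDig_t' (z : Fin K → ZMod p) :
    List.ofFn (fun i : Fin L.kt => Sum.elim z id (varDig (F := ZMod p) (@t'Slot L (dM M)) i)) =
      (t'D L.kt (zlOf M L z)).map (Nat.cast : ℕ → ZMod p) := by
  apply List.ext_getElem
  · simp
  · intro i h1 h2
    rw [List.length_ofFn] at h1
    rw [List.getElem_ofFn, List.getElem_map]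
    have := getD_t'D M L z ⟨i, h1⟩
    rw [List.getD_eq_getElem _ _ (by simpa using h2)] at this
    simp only [varDig, Sum.elim_inl]
    rw [this, ZMod.natCast_zmod_val]

/-- A window column, read. [folklore] -/
theorem ofFn_varDig_c (z : Fin K → ZMod p) (c : Fin (2 * d + 1)) :
    List.ofFn (fun i : Fin L.kJ => Sum.elim z id (varDig (F := ZMod p) (cSlot c) i)) =
      (cD L.kt L.kJ (zlOf M L z) c).map (Nat.cast : ℕ → ZMod p) := by
  have hl := length_cD M L z c.2
  apply List.ext_getElem
  · simp [hl]
  · intro i h1 h2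
    rw [List.length_ofFn] at h1
    rw [List.getElem_ofFn, List.getElem_map]
    have := getD_cD M L z c ⟨i, h1⟩
    rw [List.getD_eq_getElem _ _ (by simpa using h2)] at this
    simp only [varDig, Sum.elim_inl]
    rw [this, ZMod.natCast_zmod_val]

/-- **Reading an address built by `mkAddr`**, as a coordinate list. [folklore] -/
theorem readAddr_mkAddr_eq (z : Fin K → ZMod p) (ts : Fin L.kt → Fin K ⊕ ZMod p) (js : Fin L.kJ → Fin K ⊕ ZMod p)
    (c : ℕ) {rowl coll : List ℕ}
    (hts : List.ofFn (fun i => Sum.elim z id (ts i)) = rowl.map (Nat.cast : ℕ → ZMod p))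
    (hjs : List.ofFn (fun i => Sum.elim z id (js i)) = coll.map (Nat.cast : ℕ → ZMod p)) :
    readAddr (mkAddr ts js (c : ZMod p)) z = fun u : Fin m => (((rowl ++ (coll ++ [c])).getD (u : ℕ) 0 : ℕ) : ZMod p) := by
  rw [readAddr_mkAddr]
  have h := ofFn_mkPt (L := L) (fun i => Sum.elim z id (ts i)) (fun i => Sum.elim z id (js i)) (c : ZMod p)
  rw [hts, hjs] at h
  funext u
  rw [eq_getD_of_ofFn_eq h 0]
  simp only
  rw [show rowl.map (Nat.cast : ℕ → ZMod p) ++ (coll.map Nat.cast ++ [(c : ZMod p)]) =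
    (rowl ++ (coll ++ [c])).map (Nat.cast : ℕ → ZMod p) by simp, List.getD_eq_getElem?_getD, List.getElem?_map,
    List.getD_eq_getElem?_getD]
  cases (rowl ++ (coll ++ [c]))[(u : ℕ)]? <;> simp

/-- The generic address lemma for a descriptor read. [folklore] -/
theorem readAddr_desc (z : Fin K → ZMod p) {ts : Fin L.kt → Fin K ⊕ ZMod p} {js : Fin L.kJ → Fin K ⊕ ZMod p}
    {rs cs : ℕ × ℕ} {c : ℕ}
    (hts : List.ofFn (fun i => Sum.elim z id (ts i)) = (rowDigs L.h L.kt (zlOf M L z) rs).map (Nat.cast : ℕ → ZMod p))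
    (hjs : List.ofFn (fun i => Sum.elim z id (js i)) = (colDigs L.h L.kt L.kJ (zlOf M L z) cs).map (Nat.cast : ℕ → ZMod p)) :
    readAddr (mkAddr ts js (c : ZMod p)) z = fun u : Fin m => (((addrN L.h L.kt L.kJ (zlOf M L z) (rs, cs, c)).getD (u : ℕ) 0 : ℕ) : ZMod p) :=
  readAddr_mkAddr_eq z ts js c hts hjs

/-- Row source: constant. [folklore] -/
theorem row_const (z : Fin K → ZMod p) (t0 : ℕ) :
    List.ofFn (fun i : Fin L.kt => Sum.elim z id ((constDig L.h t0 : Fin L.kt → Fin K ⊕ ZMod p) i)) =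
      (rowDigs L.h L.kt (zlOf M L z) (0, t0)).map (Nat.cast : ℕ → ZMod p) := by
  rw [ofFn_constDig]; rfl

/-- Row source: `t`. [folklore] -/
theorem row_t (z : Fin K → ZMod p) :
    List.ofFn (fun i : Fin L.kt => Sum.elim z id (varDig (F := ZMod p) (@tSlot L (dM M)) i)) =
      (rowDigs L.h L.kt (zlOf M L z) (1, 0)).map (Nat.cast : ℕ → ZMod p) := by
  rw [ofFn_varDig_t]; rfl

/-- Row source: `t'`. [folklore] -/
theorem row_t' (z : Fin K → ZMod p) :
    List.ofFn (fun i : Fin L.kt => Sum.elim z id (varDig (F := ZMod p) (@t'Slot L (dM M)) i)) =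
      (rowDigs L.h L.kt (zlOf M L z) (2, 0)).map (Nat.cast : ℕ → ZMod p) := by
  rw [ofFn_varDig_t']; rfl

/-- Column source: constant. [folklore] -/
theorem col_const (z : Fin K → ZMod p) (J0 : ℕ) :
    List.ofFn (fun i : Fin L.kJ => Sum.elim z id ((constDig L.h J0 : Fin L.kJ → Fin K ⊕ ZMod p) i)) =
      (colDigs L.h L.kt L.kJ (zlOf M L z) (0, J0)).map (Nat.cast : ℕ → ZMod p) := by
  rw [ofFn_constDig]; rfl

/-- Column source: window column. [folklore] -/
theorem col_var (z : Fin K → ZMod p) (c : Fin (2 * d + 1)) :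
    List.ofFn (fun i : Fin L.kJ => Sum.elim z id (varDig (F := ZMod p) (cSlot c) i)) =
      (colDigs L.h L.kt L.kJ (zlOf M L z) (1, (c : ℕ))).map (Nat.cast : ℕ → ZMod p) := by
  rw [ofFn_varDig_c]; rfl

/-! #### Values -/

/-- **The value of a family `⟨r, addr, G · clausePoly prem concl⟩`** is the cast of `famValN` on the
descriptor with the guard tag of `G` and the premise/conclusion indices. [folklore] -/
theorem value_mk {r : ℕ} (addr : Fin r → Fin m → Fin K ⊕ ZMod p) (G : MvPolynomial (Fin K ⊕ Fin r) (ZMod p))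
    (prem concl : List (Fin r)) {g : ℕ} {rds : List RdDesc} {premN conclN : List ℕ}
    (hG : ∀ (z : Fin K → ZMod p) (y : Fin r → ZMod p),
      ((guardN p L.h L.kt L.kJ d n P T (zlOf M L z) g : ℕ) : ZMod p) = MvPolynomial.eval (Sum.elim z y) G)
    (hprem : prem.map Fin.val = premN) (hconcl : concl.map Fin.val = conclN)
    (z : Fin K → ZMod p) (y : Fin r → ZMod p) :
    Family.value (⟨r, addr, G * clausePoly prem concl⟩ : Family (ZMod p) K m) z y =
      ((famValN p L.h L.kt L.kJ d n P T (zlOf M L z) (List.ofFn fun j => (y j).val) (g, rds, premN, conclN) : ℕ) : ZMod p) := by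
  subst hprem hconcl
  unfold Family.value famValN
  dsimp only
  rw [map_mul, natCast_mulM, hG z y, cast_clauseN z y prem concl]

omit hp in
/-- The value code of the `j`-th listed value is `j`. [folklore] -/
theorem vcode_valOf (j : Fin (Nat.card (Val M.tm))) : vcode M (valOf M j) = j := by
  letI := Fintype.ofFinite (Val M.tm)
  unfold vcode valOf
  simp

omit hp in
/-- The premise indices of `intFam` are `0, …, 3d+1`. [folklore] -/
theorem map_val_castAdd_natAdd (a b : ℕ) :
    (((List.finRange a).map fun s => Fin.castSucc (Fin.castAdd b s)) ++
      ((List.finRange b).map fun s => Fin.castSucc (Fin.natAdd a s))).map Fin.val = List.range (a + b) := by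
  rw [List.map_append, List.map_map, List.map_map, List.range_add, ← List.map_coe_finRange_eq_range (n := a), ← List.map_coe_finRange_eq_range (n := b),
    List.map_map]
  rfl

variable (hh : L.h ≤ p)
include hh

omit hh in
/-- Guard tag `0`. [folklore] -/
theorem guard0 {r : ℕ} (z : Fin K → ZMod p) (y : Fin r → ZMod p) :
    ((guardN p L.h L.kt L.kJ d n P T (zlOf M L z) 0 : ℕ) : ZMod p) =
      MvPolynomial.eval (Sum.elim z y) (1 : MvPolynomial (Fin K ⊕ Fin r) (ZMod p)) := by
  rw [guardN, if_pos rfl, ZMod.natCast_mod, Nat.cast_one, map_one]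

/-- Guard tag `1`. [folklore] -/
theorem guard1 {r : ℕ} (z : Fin K → ZMod p) (y : Fin r → ZMod p) (hd0 : 0 < 2 * d + 1) :
    ((guardN p L.h L.kt L.kJ d n P T (zlOf M L z) 1 : ℕ) : ZMod p) =
      MvPolynomial.eval (Sum.elim z y) ((1 - LTC L.h L.kJ (NN n P + 1) (Uc M L ⟨0, hd0⟩)) *
        LTC L.h L.kJ (S1 M n P T + 1) (Uc M L ⟨0, hd0⟩)) := by
  rw [guardN, if_neg (by decide), if_pos rfl]
  exact cast_tailGN hh z y hd0

/-- Guard tag `2`. [folklore] -/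
theorem guard2 {r : ℕ} (z : Fin K → ZMod p) (y : Fin r → ZMod p) :
    ((guardN p L.h L.kt L.kJ d n P T (zlOf M L z) 2 : ℕ) : ZMod p) = MvPolynomial.eval (Sum.elim z y) (stepGuard M L T) := by
  rw [guardN, if_neg (by decide), if_neg (by decide), if_pos rfl]
  exact cast_stepGN hh z y

/-- Guard tag `3`. [folklore] -/
theorem guard3 {r : ℕ} (z : Fin K → ZMod p) (y : Fin r → ZMod p) :
    ((guardN p L.h L.kt L.kJ d n P T (zlOf M L z) 3 : ℕ) : ZMod p) = MvPolynomial.eval (Sum.elim z y) (intGuard M L n P T) := by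
  rw [guardN, if_neg (by decide), if_neg (by decide), if_neg (by decide), if_pos rfl]
  exact cast_intGN hh z y

/-- Guard tag `4`. [folklore] -/
theorem guard4 {r : ℕ} (z : Fin K → ZMod p) (y : Fin r → ZMod p) :
    ((guardN p L.h L.kt L.kJ d n P T (zlOf M L z) 4 : ℕ) : ZMod p) = MvPolynomial.eval (Sum.elim z y) (cellGuard M L n P T) := by
  rw [guardN, if_neg (by decide), if_neg (by decide), if_neg (by decide), if_neg (by decide)]
  exact cast_cellGN hh z y

/-! #### The families, one by one -/

omit hh in
/-- `unitFam` is described. [folklore] -/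
theorem described_unit (t0 J0 : ℕ) (v : Val M.tm) :
    Described (p := p) (M := M) (L := L) (n := n) (P := P) (T := T) (unitFam M L t0 J0 v) (unitD M t0 J0 v) := by
  refine ⟨rfl, fun z j => ?_, fun z y => ?_⟩
  · obtain ⟨j, hj⟩ := j
    obtain rfl : j = 0 := by change j < 1 at hj; omega
    exact readAddr_desc z (row_const z t0) (col_const z J0)
  · exact value_mk (r := 1) _ 1 [] [0] guard0 rfl rfl z y

/-- `tailFam` is described. [folklore] -/
theorem described_tail (hd0 : 0 < 2 * d + 1) :
    Described (p := p) (M := M) (L := L) (n := n) (P := P) (T := T) (tailFam M L n P T hd0) (tailD M) := by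
  refine ⟨rfl, fun z j => ?_, fun z y => ?_⟩
  · obtain ⟨j, hj⟩ := j
    obtain rfl : j = 0 := by change j < 1 at hj; omega
    exact readAddr_desc z (row_const z 0) (col_var z ⟨0, hd0⟩)
  · exact value_mk (r := 1) _ _ [] [0] (fun z y => guard1 hh z y hd0) rfl rfl z y

omit hh in
/-- `certAnyFam` is described. [folklore] -/
theorem described_certAny (j : ℕ) :
    Described (p := p) (M := M) (L := L) (n := n) (P := P) (T := T) (certAnyFam M L n j) (certAnyD M n j) := by
  refine ⟨rfl, fun z k => ?_, fun z y => ?_⟩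
  · obtain ⟨k, hk⟩ := k
    have hk3 : k < 3 := hk
    interval_cases k <;> exact readAddr_desc z (row_const z 0) (col_const z _)
  · exact value_mk (r := 3) _ 1 [] [0, 1, 2] guard0 rfl rfl z y

omit hh in
/-- `certNextFam` is described. [folklore] -/
theorem described_certNext (j : ℕ) :
    Described (p := p) (M := M) (L := L) (n := n) (P := P) (T := T) (certNextFam M L n j) (certNextD M n j) := by
  refine ⟨rfl, fun z k => ?_, fun z y => ?_⟩
  · obtain ⟨k, hk⟩ := k
    have hk2 : k < 2 := hk
    interval_cases k <;> exact readAddr_desc z (row_const z 0) (col_const z _)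
  · exact value_mk (r := 2) _ 1 [0] [1] guard0 rfl rfl z y

/-- `topFam` is described. [folklore] -/
theorem described_top (a : Fin (3 * d + 1) → Val M.tm) (r : Fin (2 * d + 1)) :
    Described (p := p) (M := M) (L := L) (n := n) (P := P) (T := T) (topFam M L T a r) (topD M a r) := by
  refine ⟨by simp [topFam, topD], fun z j => ?_, fun z y => ?_⟩
  · show readAddr (@Fin.lastCases (3 * d + 1) (fun _ => Fin m → Fin K ⊕ ZMod p)
        (mkAddr (varDig t'Slot) (constDig L.h r) (vcode M (topF d a r)))
        (fun s => mkAddr (varDig tSlot) (constDig L.h s) (vcode M (a s))) j) z = _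
    induction j using Fin.lastCases with
    | last =>
      have hk : ((topD M a r).2.1.getD ((Fin.last (3 * d + 1) : Fin (3 * d + 2)) : ℕ) ((0, 0), (0, 0), 0)) =
          ((2, 0), (0, (r : ℕ)), vc M (topF d a r)) := by
        unfold topD
        dsimp only
        rw [List.getD_eq_getElem _ _ (by simp), List.getElem_append_right (by simp)]
        simp
      rw [Fin.lastCases_last, hk]
      exact readAddr_desc z (row_t' z) (col_const z _)
    | cast s =>
      have hk : ((topD M a r).2.1.getD ((Fin.castSucc s : Fin (3 * d + 2)) : ℕ) ((0, 0), (0, 0), 0)) =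
          ((1, 0), (0, (s : ℕ)), vc M (a s)) := by
        unfold topD
        dsimp only
        have hs := s.2
        rw [List.getD_eq_getElem _ _ (by simp), List.getElem_append_left (by simp; omega)]
        simp
      rw [Fin.lastCases_castSucc, hk]
      exact readAddr_desc z (row_t z) (col_const z _)
  · refine value_mk (r := 3 * d + 2) _ _ _ _ (guard2 hh) ?_ rfl z y
    rw [List.map_map]
    exact List.map_congr_left fun s _ => rfl

/-- `intFam` is described. [folklore] -/
theorem described_int (hd' : Fin (d + 1) → Val M.tm) (nb : Fin (2 * d + 1) → Val M.tm) :
    Described (p := p) (M := M) (L := L) (n := n) (P := P) (T := T) (intFam M L n P T hd' nb) (intD M hd' nb) := by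
  refine ⟨by simp [intFam, intD]; omega, fun z j => ?_, fun z y => ?_⟩
  · show readAddr (@Fin.lastCases ((d + 1) + (2 * d + 1)) (fun _ => Fin m → Fin K ⊕ ZMod p)
        (mkAddr (varDig t'Slot) (varDig (cSlot ⟨d, by omega⟩)) (vcode M (intF d hd' nb)))
        (@Fin.addCases (d + 1) (2 * d + 1) (fun _ => Fin m → Fin K ⊕ ZMod p)
          (fun s => mkAddr (varDig tSlot) (constDig L.h s) (vcode M (hd' s)))
          (fun s => mkAddr (varDig tSlot) (varDig (cSlot s)) (vcode M (nb s)))) j) z = _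
    induction j using Fin.lastCases with
    | last =>
      have hk : ((intD M hd' nb).2.1.getD ((Fin.last ((d + 1) + (2 * d + 1)) : Fin ((d + 1) + (2 * d + 1) + 1)) : ℕ)
          ((0, 0), (0, 0), 0)) = ((2, 0), (1, d), vc M (intF d hd' nb)) := by
        unfold intD
        dsimp only
        rw [List.getD_eq_getElem _ _ (by simp), List.getElem_append_right (by simp), List.getElem_append_right (by simp)]
        simp
      rw [Fin.lastCases_last, hk]
      exact readAddr_desc z (row_t' z) (col_var z ⟨d, by omega⟩)
    | cast s =>
      rw [Fin.lastCases_castSucc]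
      induction s using Fin.addCases with
      | left s =>
        have hk : ((intD M hd' nb).2.1.getD ((Fin.castSucc (Fin.castAdd (2 * d + 1) s) :
            Fin ((d + 1) + (2 * d + 1) + 1)) : ℕ) ((0, 0), (0, 0), 0)) = ((1, 0), (0, (s : ℕ)), vc M (hd' s)) := by
          unfold intD
          dsimp only
          have hs := s.2
          rw [List.getD_eq_getElem _ _ (by simp; omega), List.getElem_append_left (by simp; omega)]
          simp
        rw [Fin.addCases_left, hk]
        exact readAddr_desc z (row_t z) (col_const z _)
      | right s =>
        have hk : ((intD M hd' nb).2.1.getD ((Fin.castSucc (Fin.natAdd (d + 1) s) :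
            Fin ((d + 1) + (2 * d + 1) + 1)) : ℕ) ((0, 0), (0, 0), 0)) = ((1, 0), (1, (s : ℕ)), vc M (nb s)) := by
          unfold intD
          dsimp only
          have hs := s.2
          rw [List.getD_eq_getElem _ _ (by simp), List.getElem_append_right (by simp),
            List.getElem_append_left (by simp; omega)]
          simp
        rw [Fin.addCases_right, hk]
        exact readAddr_desc z (row_t z) (col_var z s)
  · exact value_mk (r := (d + 1) + (2 * d + 1) + 1) _ _ _ _ (guard3 hh) (map_val_castAdd_natAdd _ _) rfl z y

/-- `botFam` is described. [folklore] -/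
theorem described_bot (r : ℕ) :
    Described (p := p) (M := M) (L := L) (n := n) (P := P) (T := T) (botFam M L n P T r) (botD M n P T r) := by
  refine ⟨rfl, fun z j => ?_, fun z y => ?_⟩
  · obtain ⟨j, hj⟩ := j
    obtain rfl : j = 0 := by change j < 1 at hj; omega
    exact readAddr_desc z (row_t' z) (col_const z _)
  · exact value_mk (r := 1) _ _ [] [0] (guard2 hh) rfl rfl z y

/-- `cellAnyFam` is described. [folklore] -/
theorem described_cellAny :
    Described (p := p) (M := M) (L := L) (n := n) (P := P) (T := T) (cellAnyFam M L n P T) (cellAnyD M) := by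
  refine ⟨by simp [cellAnyFam, cellAnyD], fun z j => ?_, fun z y => ?_⟩
  · have hk : ((cellAnyD M).2.1.getD (j : ℕ) ((0, 0), (0, 0), 0)) = ((1, 0), (1, 0), (j : ℕ)) := by
      unfold cellAnyD
      dsimp only
      rw [List.getD_eq_getElem _ _ (by rw [List.length_map, List.length_range]; exact j.2), List.getElem_map, List.getElem_range]
    rw [hk]
    show readAddr (mkAddr (varDig tSlot) (varDig (cSlot ⟨0, by omega⟩)) (vcode M (valOf M j) : ZMod p)) z = _
    rw [vcode_valOf]
    exact readAddr_desc z (row_t z) (col_var z ⟨0, by omega⟩)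
  · exact value_mk (r := Nat.card (Val M.tm)) _ _ [] _ (guard4 hh) rfl List.map_coe_finRange_eq_range z y

/-- `cellPairFam` is described. [folklore] -/
theorem described_cellPair (v v' : Val M.tm) :
    Described (p := p) (M := M) (L := L) (n := n) (P := P) (T := T) (cellPairFam M L n P T v v') (cellPairD M v v') := by
  refine ⟨rfl, fun z j => ?_, fun z y => ?_⟩
  · obtain ⟨j, hj⟩ := j
    have hj2 : j < 2 := hj
    interval_cases j <;> exact readAddr_desc z (row_t z) (col_var z ⟨0, by omega⟩)
  · exact value_mk (r := 2) _ _ [0, 1] [] (guard4 hh) rfl rfl z y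

/-! #### The lists -/

/-- **`nFams` is described by `nDescs`, in order.** [cite: BabaiFortnowLund1991, §4] -/
theorem forall₂_nFams : List.Forall₂ (Described (p := p) (M := M) (L := L) (n := n) (P := P) (T := T)) (nFams M L n P T) (nDescs M n P T) := by
  unfold nFams nDescs
  refine List.rel_append (List.rel_append (List.rel_append (List.rel_append (List.rel_append ?_ ?_) ?_) ?_) ?_) ?_
  · exact List.Forall₂.cons (described_unit _ _ _) (List.Forall₂.cons (described_unit _ _ _)
      (List.Forall₂.cons (described_unit _ _ _) (List.Forall₂.cons (described_tail hh _)
      (List.Forall₂.cons (described_unit _ _ _) (List.Forall₂.cons (described_cellAny hh) List.Forall₂.nil)))))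
  · exact forall₂_flatMap_flatMap _ fun j _ =>
      List.Forall₂.cons (described_certAny j) (List.Forall₂.cons (described_certNext j) List.Forall₂.nil)
  · exact forall₂_flatMap_flatMap _ fun a _ => forall₂_map_map _ fun r _ => described_top hh a r
  · exact forall₂_flatMap_flatMap _ fun a _ => forall₂_map_map _ fun b _ => described_int hh a b
  · exact forall₂_map_map _ fun r _ => described_bot hh r
  · refine forall₂_flatMap_flatMap _ fun v _ => forall₂_flatMap_flatMap _ fun v' _ => ?_
    by_cases hv : v = v'
    · rw [if_pos hv, if_pos hv]
      exact List.Forall₂.nil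
    · rw [if_neg hv, if_neg hv]
      exact List.Forall₂.cons (described_cellPair hh v v') List.Forall₂.nil

omit hh in
/-- **`xFams` is described by `xDescs`, in order.** [folklore] -/
theorem forall₂_xFams (x : List Bool) : List.Forall₂ (Described (p := p) (M := M) (L := L) (n := n) (P := P) (T := T)) (xFams M L x) (xDescs M x) := by
  unfold xFams xDescs
  exact forall₂_flatMap_flatMap _ fun q _ =>
    List.Forall₂.cons (described_unit _ _ _) (List.Forall₂.cons (described_unit _ _ _) List.Forall₂.nil)

/-- **The families of the tableau CSP are described by `descs`, in order.** [cite: BabaiFortnowLund1991, §4] -/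
theorem forall₂_fams_descs (x : List Bool) :
    List.Forall₂ (Described (p := p) (M := M) (L := L) (n := x.length) (P := P) (T := T)) (xFams M L x ++ nFams M L x.length P T)
      (descs M x.length P T x) :=
  List.rel_append (forall₂_xFams x) (forall₂_nFams hh)

/-! ### The CSP: arities, addresses, the seeded sum -/

/-- The number of families is the number of descriptors. [folklore] -/
theorem length_descs (x : List Bool) : (descs M x.length P T x).length = (tableauCSP (F := ZMod p) M L P T x).N :=
  (forall₂_fams_descs (M := M) (L := L) (P := P) (T := T) hh x).length_eq.symm

/-- **Arity of a family** = number of described reads. [folklore] -/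
theorem arity_eq (x : List Bool) (φ : Fin (tableauCSP (F := ZMod p) M L P T x).N) :
    ((tableauCSP (F := ZMod p) M L P T x).fam φ).arity =
      ((descs M x.length P T x).getD φ (0, [], [], [])).2.1.length := by
  have hF := forall₂_fams_descs (M := M) (L := L) (P := P) (T := T) hh x
  have hlen := hF.length_eq
  have h := hF.get φ.2 (by rw [← hlen]; exact φ.2)
  rw [List.getD_eq_getElem _ _ (by rw [← hlen]; exact φ.2)]
  exact h.1

/-- **The read addresses of the tableau CSP are the casts of `addrN`.** [cite: BabaiFortnowLund1991, §4] -/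
theorem readAddr_eq_addrN (x : List Bool) (z : Fin K → ZMod p) (φ : Fin (tableauCSP (F := ZMod p) M L P T x).N)
    (j : Fin ((tableauCSP (F := ZMod p) M L P T x).fam φ).arity) :
    readAddr (((tableauCSP (F := ZMod p) M L P T x).fam φ).addr j) z = fun u : Fin m =>
      (((addrN L.h L.kt L.kJ (zlOf M L z) (((descs M x.length P T x).getD φ (0, [], [], [])).2.1.getD j ((0, 0), (0, 0), 0))).getD (u : ℕ) 0
        : ℕ) : ZMod p) := by
  have hF := forall₂_fams_descs (M := M) (L := L) (P := P) (T := T) hh x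
  have hlen := hF.length_eq
  have h := hF.get φ.2 (by rw [← hlen]; exact φ.2)
  rw [List.getD_eq_getElem _ (0, [], [], []) (by rw [← hlen]; exact φ.2)]
  exact h.2.1 z j

/-- **The seeded sum of the constraint values is `psiN`.** For the CSP `C = tableauCSP M L P T x` over
`ZMod p` (`p` prime, `h ≤ p`), every index `z` and reads `y`:
`psiN(seed, z, y, descs) = ∑_φ seed^φ · (C.fam φ).value z (y φ)` — with `y φ j = Ŷ(readAddr (addr j) z)`
this is `Ψ_λ(z)` of `AlgebraicPCP` for `λ_φ = seed^φ`. [cite: AroraBarakCC2009, §11.5.2] [cite: BabaiFortnowLund1991, §4] -/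
theorem cast_psiN (x : List Bool) (seed : ZMod p) (z : Fin K → ZMod p)
    (y : (φ : Fin (tableauCSP (F := ZMod p) M L P T x).N) → Fin ((tableauCSP (F := ZMod p) M L P T x).fam φ).arity → ZMod p) :
    ((psiN p L.h L.kt L.kJ d x.length P T seed.val (zlOf M L z) (List.ofFn fun φ => List.ofFn fun j => (y φ j).val)
        (descs M x.length P T x) : ℕ) : ZMod p) =
      ∑ φ : Fin (tableauCSP (F := ZMod p) M L P T x).N, seed ^ φ.val * ((tableauCSP (F := ZMod p) M L P T x).fam φ).value z (y φ) := by
  have hF := forall₂_fams_descs (M := M) (L := L) (P := P) (T := T) hh x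
  have hlen : (descs M x.length P T x).length = (tableauCSP (F := ZMod p) M L P T x).N := hF.length_eq.symm
  have h2 : 2 ≤ p := hp.out.two_le
  rw [psiN, natCast_sumM, List.map_map, ← List.sum_ofFn]
  congr 1
  apply List.ext_getElem
  · simp [hlen]
  · intro i hi1 hi2
    rw [List.length_ofFn] at hi2
    rw [List.getElem_map, List.getElem_ofFn]
    simp only [Function.comp_apply, List.getElem_zip, List.getElem_range, List.getElem_ofFn]
    rw [natCast_mulM, natCast_powM h2, ZMod.natCast_val, ZMod.cast_id', id]
    congr 1
    have h := hF.get hi2 (by rw [hlen]; exact hi2)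
    exact (h.2.2 z (y ⟨i, hi2⟩)).symm

end Tab

end TabEval

end Literature.Computability.Complexity

end
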